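import Literature.AlgebraicGeometry.Motives.HyperbolicWeilType
import Summits.HodgeConjecture.HodgeConjecture.Theorems.EightfoldBlochSeedsBlochSeedsGenericPad4SeedMinimalClauses
import HarnessLib

/-!
# Route `EightfoldBlochSeeds`, cruxes `BlochSeedsGeneric` (item stmt-HodgeConjecture-18880) / `BlochSeedDiscThree` (18882), line
# `pad4-cm-anchor`, stub `stub_rung_pad4_seedAt`: THE HYPERBOLICITY CLAUSE DEPENDS ONLY ON THE LINE `ℂ·e^*a` — re-embeddings
# (Veronese / Segre twists `e^*a ↦ c·e^*a`, `c ≠ 0`) keep `(P, ψ)` hyperbolic for `h_K = d·e^*a + ψ^*e^*a`, and keep Bloch seeds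

HONEST FRAMING. Nothing here proves the stub, either crux, rung H2, HC_AV or the Hodge conjecture; nothing is constructed.
UNCONDITIONAL `--supports` lemmas (no named fact as hypothesis, no definition, no Literature fact; D-0026). Census-neutral.

WHAT IS HERE (leafhand `leafhand-hodge-eightfoldblochseed-1-g1`). The rung stub asks for ONE projective embedding `e` (rational `a ≠ 0`)
serving two masters: `(S⁴, Ψ)` must be HYPERBOLIC for `h_K(e, a) = d·e^*a + Ψ^*e^*a` (the tree supplies such an `e₀`:
`pad4Anchor_hyperbolic_weilClass`), and the designer's seed must carry `q·h_K(e, a)⁴ + w` — designers twist (`h ↦ t·h`, high twists of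
the presentation) and re-embed. This file records, at general `(P, ψ, d, n)`, that both clauses see only the LINE `ℂ·e^*a`:

* `ksymm_eq_smul_of_map_eq_smul` — if `e'^*a' = c·e^*a` then `h_K(e', a') = c·h_K(e, a)`.
* `isHyperbolicWeilType_ksymm_iff_of_map_eq_smul` — for `c ≠ 0`, hyperbolicity for `h_K(e', a')` ↔ for `h_K(e, a)` (the tree's
  `isHyperbolicWeilType_smul_iff`: `Q_{ch} = c^{2n-1}·Q_h`).
* `hasBlochSeedAt_ksymm_iff_of_map_eq_ratCast_smul` — for a RATIONAL `c ≠ 0`, `HasBlochSeedAt n P (h_K(e', a')) w ↔ HasBlochSeedAt n P (h_K(e, a)) w`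
  (g0's `hasBlochSeedAt_ratSmul_iff`: `q ↦ q·cⁿ`).
So a designer may take the tree's hyperbolic `(e₀, a₀)` and ANY re-embedding `e` with `e^*a ∈ ℚ^×·e₀^*a₀` (e.g. the `t`-th Veronese
re-embedding, `e^*[H] = t·e₀^*[H]`) without re-proving hyperbolicity; conversely hyperbolicity is NOT automatic for a K-symmetric ample
class off that line (the Weil discriminant of a product polarisation with weights `λ₁, …, λ₈` on `E₀⁸` is `∏ λᵢ mod N(ℚ(√-d)^×)`, van Geemen
5.4 — not formalised here).

## References

[cite: vanGeemen1994HodgeAV, Lemma 5.2 (2)–(3) and 5.4 (5.4.1)] [cite: Bloch1972Semiregularity, Remark (7.5)] [cite: HatcherAT2002, §3.2]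
-/

noncomputable section

-- single-problem summit (Problem = Summit): the mandated namespace repeats `HodgeConjecture`.
set_option linter.dupNamespace false

open CategoryTheory AlgebraicGeometry
open Literature.AlgebraicGeometry Literature.AlgebraicGeometry.Motives Literature.AlgebraicGeometry.HodgeTheory
open Literature.AlgebraicTopology.SingularHomology

namespace Summit.HodgeConjecture.HodgeConjecture.Theorems

variable {P : AbelianVariety ℂ} (ψ : P ⟶ P) (d : ℕ) {n : ℕ}

/-- **`h_K` is linear in the hyperplane class**: if `e'^*a' = c·e^*a` then `d·e'^*a' + ψ^*e'^*a' = c·(d·e^*a + ψ^*e^*a)`.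
[cite: HatcherAT2002, §3.2] -/
theorem ksymm_eq_smul_of_map_eq_smul (e e' : ProjectiveEmbedding P.X) {a : complexBetti (projectiveSpace e.n ℂ) 2}
    {a' : complexBetti (projectiveSpace e'.n ℂ) 2} {c : ℂ} (hc : complexBetti.map e'.ι 2 a' = c • complexBetti.map e.ι 2 a) :
    (d : ℂ) • complexBetti.map e'.ι 2 a' + complexBetti.map ψ.hom.hom.hom 2 (complexBetti.map e'.ι 2 a') =
      c • ((d : ℂ) • complexBetti.map e.ι 2 a + complexBetti.map ψ.hom.hom.hom 2 (complexBetti.map e.ι 2 a)) := by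
  rw [hc, map_smul, smul_add, smul_comm]

/-- **Hyperbolicity sees only the line `ℂ·e^*a`**: if `e'^*a' = c·e^*a` with `c ≠ 0`, then `(P, ψ)` is hyperbolic in half-dimension `n`
for `h_K(e', a')` iff for `h_K(e, a)` (`Q_{c h} = c^{2n-1} Q_h`, the tree's `isHyperbolicWeilType_smul_iff`). In the rung stub a designer may
therefore replace the tree's hyperbolic embedding by any re-embedding on the same rational ray. [cite: vanGeemen1994HodgeAV, Lemma 5.2 (2)–(3) and 5.4 (5.4.1)] -/
theorem isHyperbolicWeilType_ksymm_iff_of_map_eq_smul (e e' : ProjectiveEmbedding P.X) {a : complexBetti (projectiveSpace e.n ℂ) 2}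
    {a' : complexBetti (projectiveSpace e'.n ℂ) 2} {c : ℂ} (hc0 : c ≠ 0)
    (hc : complexBetti.map e'.ι 2 a' = c • complexBetti.map e.ι 2 a) :
    IsHyperbolicWeilType P ψ n
        ((d : ℂ) • complexBetti.map e'.ι 2 a' + complexBetti.map ψ.hom.hom.hom 2 (complexBetti.map e'.ι 2 a')) ↔
      IsHyperbolicWeilType P ψ n
        ((d : ℂ) • complexBetti.map e.ι 2 a + complexBetti.map ψ.hom.hom.hom 2 (complexBetti.map e.ι 2 a)) := by
  rw [ksymm_eq_smul_of_map_eq_smul ψ d e e' hc]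
  exact isHyperbolicWeilType_smul_iff hc0

/-- **Bloch seeds see only the rational ray `ℚ^×·e^*a`**: if `e'^*a' = c·e^*a` with `c ∈ ℚ^×`, then
`HasBlochSeedAt n P (h_K(e', a')) w ↔ HasBlochSeedAt n P (h_K(e, a)) w` — the same subscheme serves, with `q ↦ q·cⁿ`
(g0's `hasBlochSeedAt_ratSmul_iff`). [cite: Bloch1972Semiregularity, Remark (7.5)] [cite: HatcherAT2002, §3.2] -/
theorem hasBlochSeedAt_ksymm_iff_of_map_eq_ratCast_smul (e e' : ProjectiveEmbedding P.X) {a : complexBetti (projectiveSpace e.n ℂ) 2}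
    {a' : complexBetti (projectiveSpace e'.n ℂ) 2} {c : ℚ} (hc0 : c ≠ 0)
    (hc : complexBetti.map e'.ι 2 a' = ((c : ℚ) : ℂ) • complexBetti.map e.ι 2 a) (w : complexBetti P.X (2 * n)) :
    HasBlochSeedAt n P
        ((d : ℂ) • complexBetti.map e'.ι 2 a' + complexBetti.map ψ.hom.hom.hom 2 (complexBetti.map e'.ι 2 a')) w ↔
      HasBlochSeedAt n P
        ((d : ℂ) • complexBetti.map e.ι 2 a + complexBetti.map ψ.hom.hom.hom 2 (complexBetti.map e.ι 2 a)) w := by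
  rw [ksymm_eq_smul_of_map_eq_smul ψ d e e' hc]
  exact hasBlochSeedAt_ratSmul_iff hc0

end Summit.HodgeConjecture.HodgeConjecture.Theorems

end
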